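import Mathlib
import Summits.Ventures.PercRepro.TriangleCapOneTriangleD

/-!
# PercRepro — the second sparse exception of the one-triangle case: `w` has no private neighbour and no vertex
is outer, so `2m ≤ 6 + 2a + 2b + 2ab` (p3, gen 35; part 35e)

In a `K₄⁻`-free graph whose every triangle is `{u, v, w}`, if `priv w = ∅` and `outer = ∅` then every vertex is
`u, v, w`, a private neighbour of `u` (`a` of them) or of `v` (`b` of them); the degrees are `a + 2`, `b + 2`, `2`,
at most `b + 1` on `priv u` (an edge inside `priv u` would be a second triangle) and at most `a + 1` on `priv v`,
so `2m = Σ deg ≤ 6 + 2a + 2b + 2ab` (`sparse_of_priv_one`).  At `k = 7`, `(a, b) = (3, 1)` gives `m ≤ 10`: the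
one-triangle case of the stability at the cell `(7, 11)` (m = 11) escapes the partitions where
`2q + ab + bc + ca < 4`.  Axioms: standard.
-/

namespace PercRepro

namespace TriangleCap

namespace C047

open Finset

variable {V : Type*} [Fintype V] [DecidableEq V]

/-- **THE SECOND SPARSE EXCEPTION:** `priv w = ∅`, `outer = ∅`, every triangle on `{u, v, w}`:
`2m ≤ 6 + 2a + 2b + 2ab` with `a = |priv u|`, `b = |priv v|`. -/
theorem sparse_of_priv_one (D : SimpleGraph V) [DecidableRel D.Adj] (hK : K4mFree D) {u v w : V}
    (huv : D.Adj u v) (huw : D.Adj u w) (hvw : D.Adj v w)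
    (hT : ∀ a b c, D.Adj a b → D.Adj a c → D.Adj b c → a = u ∨ a = v ∨ a = w)
    (hw : priv D w u v = ∅) (hQ : outer D u v w = ∅) :
    2 * D.edgeFinset.card ≤ 6 + 2 * (priv D u v w).card + 2 * (priv D v u w).card +
      2 * ((priv D u v w).card * (priv D v u w).card) := by
  set a := (priv D u v w).card with ha
  set b := (priv D v u w).card with hb
  -- the pointwise degree bound
  have hdeg : ∀ x, deg D x ≤ (if x = u then a + 2 else 0) + (if x = v then b + 2 else 0) +
      (if x = w then 2 else 0) + (if x ∈ priv D u v w then 1 + b else 0) +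
      (if x ∈ priv D v u w then 1 + a else 0) := by
    intro x
    rcases classify_triangle D hK huv huw hvw x with rfl | rfl | rfl | hx | hx | hx | hx
    · -- `x = u`: neighbours `v`, `w`, and the private neighbours
      have h1 : x ∉ priv D x v w := by rw [mem_priv]; exact fun h => h.1.ne rfl
      have h2 : x ∉ priv D v x w := by rw [mem_priv]; exact fun h => h.2.2 huw.symm
      simp only [if_true, if_neg huv.ne, if_neg huw.ne, if_neg h1, if_neg h2, add_zero]
      have hsub : ∀ y, D.Adj x y → y ∈ insert v (insert w (priv D x v w)) := by
        intro y hy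
        rcases classify_triangle D hK huv huw hvw y with rfl | rfl | rfl | h | h | h | h
        · exact (hy.ne rfl).elim
        · simp
        · simp
        · exact mem_insert_of_mem (mem_insert_of_mem h)
        · rw [mem_priv] at h; exact (h.2.1 hy).elim
        · rw [mem_priv] at h; exact (h.2.1 hy).elim
        · rw [mem_outer] at h; exact (h.1 hy).elim
      have hd := deg_le_of_subset D x _ hsub
      have c1 := card_insert_le v (insert w (priv D x v w))
      have c2 := card_insert_le w (priv D x v w)
      omega
    · -- `x = v`: neighbours `u`, `w`, and the private neighbours of `v`
      have h1 : x ∉ priv D u x w := by rw [mem_priv]; exact fun h => h.2.2 hvw.symm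
      have h2 : x ∉ priv D x u w := by rw [mem_priv]; exact fun h => h.1.ne rfl
      simp only [if_true, if_neg huv.ne.symm, if_neg hvw.ne, if_neg h1, if_neg h2, add_zero, zero_add]
      have hsub : ∀ y, D.Adj x y → y ∈ insert u (insert w (priv D x u w)) := by
        intro y hy
        rcases classify_triangle D hK huv huw hvw y with rfl | rfl | rfl | h | h | h | h
        · simp
        · exact (hy.ne rfl).elim
        · simp
        · rw [mem_priv] at h; exact (h.2.1 hy).elim
        · exact mem_insert_of_mem (mem_insert_of_mem h)
        · rw [mem_priv] at h; exact (h.2.2 hy).elim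
        · rw [mem_outer] at h; exact (h.2.1 hy).elim
      have hd := deg_le_of_subset D x _ hsub
      have c1 := card_insert_le u (insert w (priv D x u w))
      have c2 := card_insert_le w (priv D x u w)
      omega
    · -- `x = w`: neighbours `u`, `v` only
      have h1 : x ∉ priv D u v x := by rw [mem_priv]; exact fun h => h.2.1 hvw
      have h2 : x ∉ priv D v u x := by rw [mem_priv]; exact fun h => h.2.1 huw
      simp only [if_true, if_neg huw.ne.symm, if_neg hvw.ne.symm, if_neg h1, if_neg h2, add_zero,
        zero_add]
      have hsub : ∀ y, D.Adj x y → y ∈ ({u, v} : Finset V) := by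
        intro y hy
        rcases classify_triangle D hK huv huw hvw y with rfl | rfl | rfl | h | h | h | h
        · simp
        · simp
        · exact (hy.ne rfl).elim
        · rw [mem_priv] at h; exact (h.2.2 hy).elim
        · rw [mem_priv] at h; exact (h.2.2 hy).elim
        · rw [hw] at h; exact (notMem_empty _ h).elim
        · rw [mem_outer] at h; exact (h.2.2 hy).elim
      exact le_trans (deg_le_of_subset D x _ hsub) card_le_two
    · -- `x ∈ priv u`: neighbours `u` and private neighbours of `v`
      have hx' := (mem_priv D u v w x).mp hx
      have hxu : x ≠ u := fun h => hx'.1.ne h.symm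
      have hxv : x ≠ v := fun h => hx'.2.2 (h ▸ hvw.symm)
      have hxw : x ≠ w := fun h => hx'.2.1 (h ▸ hvw)
      have h2 : x ∉ priv D v u w := by rw [mem_priv]; exact fun h => hx'.2.1 h.1
      simp only [if_neg hxu, if_neg hxv, if_neg hxw, if_pos hx, if_neg h2, add_zero, zero_add]
      have hsub : ∀ y, D.Adj x y → y ∈ insert u (priv D v u w) := by
        intro y hy
        rcases classify_triangle D hK huv huw hvw y with rfl | rfl | rfl | h | h | h | h
        · exact mem_insert_self _ _
        · exact (hx'.2.1 hy.symm).elim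
        · exact (hx'.2.2 hy.symm).elim
        · -- a second triangle `u x y`
          exfalso
          have h' := (mem_priv D u v w y).mp h
          rcases hT x u y hx'.1.symm hy h'.1 with h3 | h3 | h3
          · exact hxu h3
          · exact hxv h3
          · exact hxw h3
        · exact mem_insert_of_mem h
        · rw [hw] at h; exact (notMem_empty _ h).elim
        · rw [hQ] at h; exact (notMem_empty _ h).elim
      have hd := deg_le_of_subset D x _ hsub
      have c1 := card_insert_le u (priv D v u w)
      omega
    · -- `x ∈ priv v`: neighbours `v` and private neighbours of `u`
      have hx' := (mem_priv D v u w x).mp hx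
      have hxu : x ≠ u := fun h => hx'.2.2 (h ▸ huw.symm)
      have hxv : x ≠ v := fun h => hx'.1.ne h.symm
      have hxw : x ≠ w := fun h => hx'.2.1 (h ▸ huw)
      have h1 : x ∉ priv D u v w := by rw [mem_priv]; exact fun h => hx'.2.1 h.1
      simp only [if_neg hxu, if_neg hxv, if_neg hxw, if_neg h1, if_pos hx, add_zero, zero_add]
      have hsub : ∀ y, D.Adj x y → y ∈ insert v (priv D u v w) := by
        intro y hy
        rcases classify_triangle D hK huv huw hvw y with rfl | rfl | rfl | h | h | h | h
        · exact (hx'.2.1 hy.symm).elim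
        · exact mem_insert_self _ _
        · exact (hx'.2.2 hy.symm).elim
        · exact mem_insert_of_mem h
        · -- a second triangle `v x y`
          exfalso
          have h' := (mem_priv D v u w y).mp h
          rcases hT x v y hx'.1.symm hy h'.1 with h3 | h3 | h3
          · exact hxu h3
          · exact hxv h3
          · exact hxw h3
        · rw [hw] at h; exact (notMem_empty _ h).elim
        · rw [hQ] at h; exact (notMem_empty _ h).elim
      have hd := deg_le_of_subset D x _ hsub
      have c1 := card_insert_le v (priv D u v w)
      omega
    · rw [hw] at hx; exact (notMem_empty _ hx).elim
    · rw [hQ] at hx; exact (notMem_empty _ hx).elim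
  have hsum := sum_le_sum (fun x (_ : x ∈ univ) => hdeg x)
  rw [sum_deg_eq] at hsum
  simp only [sum_add_distrib, sum_ite_eq', mem_univ, if_true, sum_ite_mem, univ_inter, sum_const,
    smul_eq_mul] at hsum
  rw [← ha, ← hb] at hsum
  nlinarith [hsum]

end C047

end TriangleCap

end PercRepro
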